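import Summits.Ventures.GridStability.Bench.WSCC9Deg4ASosgramDinstData1
import Summits.Ventures.GridStability.Lyapunov.PolyRecastBox
import Mathlib.Tactic.Linarith
import Mathlib.Tactic.Positivity
import HarnessLib

/-!
# «G1.WSCC9+ deg-4 (D-instance)» — REGION-SIZE rider «WSCC9-DEG4 BALL» (recast half): the weighted Euclidean ball
# `Σ(σ² + κ²) + Σω²/64 ≤ (241/1000)²` on `{h = 0}` lies in the certified sublevel piece `{V₄ ≤ 1159/1000}`

Venture GRIDFUSION, cell `gridfusion`; seat gridfusion-lyap-2 (g3), LOW rider (pattern of «#76′ BALL» / «#50′ BALL»): a kernel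
INNER description of the certified set of the deg-4 WSCC9 D-instance certificate (`Bench/WSCC9Deg4ASosgramDinst*`, certnum-sdp-3 A′ exact
re-cert `9d83c75afa575de8` of sos-3's deg-4 claim instance `741461ba`; -roa companions `WSCC9Deg4ASosgramDinstRoa(+Model).lean`, #62), so that
the 3-machine 9-bus ROA sentence names a concrete neighbourhood of the post-fault equilibrium. Inputs: the degree-4 literal
`…_V_poly` (253 monomials) and the recast constraints `…_h1`, `…_h2` of Data1; the generic box majorant
`Lyapunov/PolyRecastBox.lean` (p536818). NOTHING of the certificate is restated; generator `gen_ball_wscc9.py` (HOME/lean/lyap-2/g3/).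

WHAT IS PROVED (kernel). With `s = 241/1000`: on `{h₁ = h₂ = 0}` the weighted ball `φ := Σᵢ(σᵢ² + κᵢ²) + Σⱼ ωⱼ²/64 ≤ s²`
(`φ` = the certificate's positivity gauge) forces `|σᵢ| ≤ s`, `0 ≤ κᵢ ≤ s²/2`, `|ωⱼ| ≤ 8s`, and the coefficient majorant of the
quartic `V` on that box is `absBox B V_poly ≤ 1159/1000` (ONE `decide`; value ≈ 1.150410); hence `V ≤ 1159/1000 = c` — THE BALL
LIES IN THE CERTIFIED PIECE (`…_V_le_level_of_ball`). `s` is the largest multiple of `1/1000` passing the test. In machine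
coordinates (`σ² + κ² = 2 − 2cos u ≤ u²`): every state with `u₂² + u₃² + (ω₁² + ω₂² + ω₃²)/64 ≤ (241/1000)²` — ONE relative rotor angle
displaced by ≤ 0.241 rad = 13.8°, or both by ≤ 9.8°, or one speed deviation ≤ 1.93 rad/s — starts inside the certified
region (model half: sibling `…RoaBallModel.lean`).

THREE COLUMNS. CERTIFIED (kernel): the inclusion «weighted ball of radius `241/1000` ∩ {h = 0} ⊆ {V ≤ 1159/1000}» for the
D-instance certificate's `V` — a crude (coefficient-majorant) but exact inner estimate; the true inner radius is larger. MODELLED: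
as the parent row (M′ = WSCC9-postB-SPdamp-h12: model-1's `WSCC9.postB_SPdamp` classical 3-machine model, post-fault-B Kron reduction
with transfer conductances, uniform-ratio damping DECLARED; MODEL-VALIDITY MV-2+MV-P+MV-SPD+MV-ω+MV-h12). VALIDATED: nothing here
(bench/G1-LOG.md has the simulated ROA coverage of the same piece). No sentence here says a grid is stable.
-/

namespace Summit.Ventures.GridStability.Bench.WSCC9

open Literature.Computation.Certificates Literature.Computation.Certificates.SOS
open Literature.Computation.Certificates.SOS.Poly
open Summit.Ventures.GridStability.Lyapunov

noncomputable section

/-- The box of the rider: `|σᵢ| ≤ s`, `|κᵢ| ≤ s²/2`, `|ωⱼ| ≤ 8s` with `s = 241/1000`, in the certificate's variable order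
`(σ₂, κ₂, σ₃, κ₃, ω₁, ω₂, ω₃)`. [folklore] -/
def deg4_A_sosgram_Dinst_boxB : List ℚ := [241/1000, 58081/2000000, 241/1000, 58081/2000000, 241/125, 241/125, 241/125]

set_option maxRecDepth 100000 in
/-- **The coefficient majorant of the quartic `V` on the box is below the level**: `absBox B V_poly ≤ 1159/1000`
(ONE `decide` over the 253 monomials). [folklore] -/
theorem deg4_A_sosgram_Dinst_absBox_le :
    PolyRecast.absBox (vars deg4_A_sosgram_Dinst_boxB) deg4_A_sosgram_Dinst_V_poly ≤ 1159 / 1000 := by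
  decide +kernel

/-- **«WSCC9-DEG4 BALL» (recast coordinates): the weighted ball lies in the certified piece.** For every point of
`{h₁ = h₂ = 0}` with `Σ(σᵢ² + κᵢ²) + Σωⱼ²/64 ≤ (241/1000)²`: `V ≤ 1159/1000`. [folklore] -/
theorem deg4_A_sosgram_Dinst_V_le_level_of_ball (sigma_2 kappa_2 sigma_3 kappa_3 omega_1 omega_2 omega_3 : ℝ)
    (hh1 : deg4_A_sosgram_Dinst_h1 sigma_2 kappa_2 sigma_3 kappa_3 omega_1 omega_2 omega_3 = 0) (hh2 : deg4_A_sosgram_Dinst_h2 sigma_2 kappa_2 sigma_3 kappa_3 omega_1 omega_2 omega_3 = 0)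
    (hball : sigma_2 ^ 2 + kappa_2 ^ 2 + sigma_3 ^ 2 + kappa_3 ^ 2 + omega_1 ^ 2 / 64 + omega_2 ^ 2 / 64 + omega_3 ^ 2 / 64 ≤ (241 / 1000 : ℝ) ^ 2) :
    deg4_A_sosgram_Dinst_V sigma_2 kappa_2 sigma_3 kappa_3 omega_1 omega_2 omega_3 ≤ 1159 / 1000 := by
  simp only [deg4_A_sosgram_Dinst_h1, deg4_A_sosgram_Dinst_h1_poly, eval_cons, eval_nil, Monomial.eval_eq, Monomial.evalFrom_cons, Monomial.evalFrom_nil,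
    vars_cons_zero, vars_cons_succ] at hh1
  push_cast at hh1
  simp only [deg4_A_sosgram_Dinst_h2, deg4_A_sosgram_Dinst_h2_poly, eval_cons, eval_nil, Monomial.eval_eq, Monomial.evalFrom_cons, Monomial.evalFrom_nil,
    vars_cons_zero, vars_cons_succ] at hh2
  push_cast at hh2
  norm_num at hh1 hh2
  have hs2 : |sigma_2| ≤ (241 / 1000 : ℝ) := abs_le.2 (abs_le_of_sq_le_sq' (by nlinarith [sq_nonneg sigma_2, sq_nonneg kappa_2, sq_nonneg sigma_3, sq_nonneg kappa_3, sq_nonneg omega_1, sq_nonneg omega_2, sq_nonneg omega_3]) (by norm_num))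
  have hs3 : |sigma_3| ≤ (241 / 1000 : ℝ) := abs_le.2 (abs_le_of_sq_le_sq' (by nlinarith [sq_nonneg sigma_2, sq_nonneg kappa_2, sq_nonneg sigma_3, sq_nonneg kappa_3, sq_nonneg omega_1, sq_nonneg omega_2, sq_nonneg omega_3]) (by norm_num))
  have hk2 : |kappa_2| ≤ (58081 / 2000000 : ℝ) := abs_le.2 ⟨by nlinarith [hh1, sq_nonneg sigma_2, sq_nonneg kappa_2, sq_nonneg sigma_3, sq_nonneg kappa_3, sq_nonneg omega_1, sq_nonneg omega_2, sq_nonneg omega_3], by nlinarith [hh1, hball, sq_nonneg sigma_2, sq_nonneg kappa_2, sq_nonneg sigma_3, sq_nonneg kappa_3, sq_nonneg omega_1, sq_nonneg omega_2, sq_nonneg omega_3]⟩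
  have hk3 : |kappa_3| ≤ (58081 / 2000000 : ℝ) := abs_le.2 ⟨by nlinarith [hh2, sq_nonneg sigma_2, sq_nonneg kappa_2, sq_nonneg sigma_3, sq_nonneg kappa_3, sq_nonneg omega_1, sq_nonneg omega_2, sq_nonneg omega_3], by nlinarith [hh2, hball, sq_nonneg sigma_2, sq_nonneg kappa_2, sq_nonneg sigma_3, sq_nonneg kappa_3, sq_nonneg omega_1, sq_nonneg omega_2, sq_nonneg omega_3]⟩
  have ho1 : |omega_1| ≤ (241 / 125 : ℝ) := abs_le.2 (abs_le_of_sq_le_sq' (by nlinarith [sq_nonneg sigma_2, sq_nonneg kappa_2, sq_nonneg sigma_3, sq_nonneg kappa_3, sq_nonneg omega_1, sq_nonneg omega_2, sq_nonneg omega_3]) (by norm_num))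
  have ho2 : |omega_2| ≤ (241 / 125 : ℝ) := abs_le.2 (abs_le_of_sq_le_sq' (by nlinarith [sq_nonneg sigma_2, sq_nonneg kappa_2, sq_nonneg sigma_3, sq_nonneg kappa_3, sq_nonneg omega_1, sq_nonneg omega_2, sq_nonneg omega_3]) (by norm_num))
  have ho3 : |omega_3| ≤ (241 / 125 : ℝ) := abs_le.2 (abs_le_of_sq_le_sq' (by nlinarith [sq_nonneg sigma_2, sq_nonneg kappa_2, sq_nonneg sigma_3, sq_nonneg kappa_3, sq_nonneg omega_1, sq_nonneg omega_2, sq_nonneg omega_3]) (by norm_num))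
  have hB : ∀ i, |vars [sigma_2, kappa_2, sigma_3, kappa_3, omega_1, omega_2, omega_3] i| ≤ ((vars deg4_A_sosgram_Dinst_boxB i : ℚ) : ℝ) := by
    intro i
    match i with
    | 0 => simpa [deg4_A_sosgram_Dinst_boxB] using hs2
    | 1 => simpa [deg4_A_sosgram_Dinst_boxB] using hk2
    | 2 => simpa [deg4_A_sosgram_Dinst_boxB] using hs3
    | 3 => simpa [deg4_A_sosgram_Dinst_boxB] using hk3
    | 4 => simpa [deg4_A_sosgram_Dinst_boxB] using ho1
    | 5 => simpa [deg4_A_sosgram_Dinst_boxB] using ho2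
    | 6 => simpa [deg4_A_sosgram_Dinst_boxB] using ho3
    | n + 7 => simp [deg4_A_sosgram_Dinst_boxB, vars]
  have h := PolyRecast.eval_le_absBox hB deg4_A_sosgram_Dinst_V_poly
  have hc : ((PolyRecast.absBox (vars deg4_A_sosgram_Dinst_boxB) deg4_A_sosgram_Dinst_V_poly : ℚ) : ℝ) ≤ ((1159 / 1000 : ℚ) : ℝ) :=
    Rat.cast_le.2 deg4_A_sosgram_Dinst_absBox_le
  have hc' : ((1159 / 1000 : ℚ) : ℝ) = 1159 / 1000 := by norm_num
  exact h.trans (hc.trans_eq hc')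

end

end Summit.Ventures.GridStability.Bench.WSCC9
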